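import Literature.Geometry.Kaehler.HolomorphicLineBundleCechTwist
import Literature.Geometry.Kaehler.HolomorphicLineBundlePullback
import HarnessLib

/-!
# Pulling back the Čech complex of a cocycle line bundle along a holomorphic map

Layer `Literature/Geometry/Kaehler`, companion of `HolomorphicLineBundleCech` (the Čech complex
`C^•(𝔙, 𝒪(L))` of a framed cover) and `HolomorphicLineBundlePullback` (the inverse image `ψ^* L`
of a cocycle line bundle along a holomorphic map `ψ : M' → M`, same index type, cocycle `g_ij ∘ ψ`).
For the restriction of sections to (the manifold structure of) a hyperplane section — the second
arrow of Serre's sequence `0 → 𝒪(L) →ᵗ 𝒪(L(H)) → 𝒪_H(L(H)) → 0` read on Čech cochains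
(J.-P. Serre, *FAC* (1955) n° 81; *GAGA* (1956) n° 16 Lemme 8) — we need the cochain map
`c ↦ c ∘ ψ`:

* `FramedCover.comap C ψ hψ` — the framed cover `(ψ⁻¹ V_k, frame k)` of `M'` for `ψ^* L`;
* `FramedCover.IsComap C C' ψ` — the predicate "`C'` (a framed cover for a bundle `L'` on `M'`) is
  the pull-back of `C` along `ψ`": members `ψ⁻¹ V_k`, same frames, `g'_ij = g_ij ∘ ψ` (satisfied by
  `comap`, `isComap_comap`, and stable under further pull-back, which lets restriction maps between
  two pulled-back covers be treated on the same footing);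
* `IsComap.cochainMap` — **the cochain map `c ↦ c ∘ ψ`**, `C^a(𝔙, 𝒪(L)) → C^a(ψ⁻¹𝔙, 𝒪(L'))`,
  commuting with the differentials (`delta_cochainMap`), whence `IsComap.cohomologyMap`;
* `IsComap.cochainMap_mulCochain` — **compatibility with multiplication by a section** `t` of
  `Hom(L, K)` and its pull-back `t ∘ ψ` (`HomSection.pullback`): restriction commutes with
  `𝒪(L) →ᵗ 𝒪(K)`, the commuting square of Serre's diagram.

Everything is proved; the definitions are `comap`, `IsComap`, `cochainMap`, `cohomologyMap` and
`HomSection.pullback`.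

## References

* J.-P. Serre, *Faisceaux algébriques cohérents*, Ann. of Math. 61 (1955), n° 81. [SerreFAC1955]
* J.-P. Serre, *Géométrie algébrique et géométrie analytique*, Ann. Inst. Fourier 6 (1956), n° 16
  Lemme 8. [SerreGAGA1956]
* P. Griffiths, J. Harris, *Principles of Algebraic Geometry* (1978), Ch. 1 §1 p. 134 (pull-back
  bundle). [GriffithsHarris1978]
-/

noncomputable section

open scoped Manifold ContDiff Topology
open Set Filter Function Literature.Algebra.Homology

namespace Literature.Geometry.Kaehler

namespace HolomorphicLineBundle

variable {ι κ : Type*} {E : Type*} [NormedAddCommGroup E] [NormedSpace ℂ E]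
  {E' : Type*} [NormedAddCommGroup E'] [NormedSpace ℂ E']
  {M : Type*} [TopologicalSpace M] [ChartedSpace E M]
  {M' : Type*} [TopologicalSpace M'] [ChartedSpace E' M']

/-! ### Pull-back of a section of `Hom(L, K)` -/

/-- **The pull-back `ψ^* t` of a section of `Hom(L, K)`**: coordinates `t_i ∘ ψ`. [cite: GriffithsHarris1978, Ch. 1 §1 p. 134] -/
def HomSection.pullback {L K : HolomorphicLineBundle ι E M} (t : HomSection L K) (ψ : M' → M)
    (hψ : MDifferentiable 𝓘(ℂ, E') 𝓘(ℂ, E) ψ) : HomSection (L.pullback ψ hψ) (K.pullback ψ hψ) where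
  coord i x := t.coord i (ψ x)
  mdifferentiableOn_coord i := (t.mdifferentiableOn_coord i).comp hψ.mdifferentiableOn fun _ hx ↦ hx
  coordChange_mul_coord i j x hx := t.coordChange_mul_coord i j (ψ x) hx

/-- The coordinates of the pulled-back section (definitional). [folklore] -/
@[simp]
theorem HomSection.pullback_coord {L K : HolomorphicLineBundle ι E M} (t : HomSection L K) (ψ : M' → M)
    (hψ : MDifferentiable 𝓘(ℂ, E') 𝓘(ℂ, E) ψ) (i : ι) (x : M') : (t.pullback ψ hψ).coord i x = t.coord i (ψ x) :=
  rfl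

namespace FramedCover

/-! ### The pulled-back framed cover -/

/-- **The pulled-back framed cover `ψ⁻¹𝔙 = (ψ⁻¹ V_k, frame k)`** of `M'` for `ψ^* L`. [cite: SerreFAC1955, n° 81] -/
def comap {L : HolomorphicLineBundle ι E M} (C : L.FramedCover κ) (ψ : M' → M)
    (hψ : MDifferentiable 𝓘(ℂ, E') 𝓘(ℂ, E) ψ) : (L.pullback ψ hψ).FramedCover κ where
  U k := ψ ⁻¹' C.U k
  isOpen k := (C.isOpen k).preimage hψ.continuous
  frame := C.frame
  subset k := preimage_mono (C.subset k)

/-- The members of the pulled-back cover (definitional). [folklore] -/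
@[simp]
theorem comap_U {L : HolomorphicLineBundle ι E M} (C : L.FramedCover κ) (ψ : M' → M)
    (hψ : MDifferentiable 𝓘(ℂ, E') 𝓘(ℂ, E) ψ) (k : κ) : (C.comap ψ hψ).U k = ψ ⁻¹' C.U k :=
  rfl

/-- The frames of the pulled-back cover (definitional). [folklore] -/
@[simp]
theorem comap_frame {L : HolomorphicLineBundle ι E M} (C : L.FramedCover κ) (ψ : M' → M)
    (hψ : MDifferentiable 𝓘(ℂ, E') 𝓘(ℂ, E) ψ) (k : κ) : (C.comap ψ hψ).frame k = C.frame k :=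
  rfl

/-- The pulled-back cover covers `M'` when `𝔙` covers `M`. [folklore] -/
theorem comap_covers {L : HolomorphicLineBundle ι E M} (C : L.FramedCover κ) (ψ : M' → M)
    (hψ : MDifferentiable 𝓘(ℂ, E') 𝓘(ℂ, E) ψ) (hcov : ∀ x : M, ∃ k, x ∈ C.U k) (x' : M') :
    ∃ k, x' ∈ (C.comap ψ hψ).U k :=
  hcov (ψ x')

/-! ### The predicate "is the pull-back along `ψ`" -/

/-- **`C'` is the pull-back of `C` along `ψ`**: the framed cover `C'` of `M'` for a bundle `L'` (same
index types) has members `ψ⁻¹ V_k`, the same frames, and `L'` has transition functions `g_ij ∘ ψ`.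
This holds for `C.comap ψ hψ` and `L' = ψ^* L` (`isComap_comap`), and — the reason for a predicate
rather than a construction — for two pulled-back covers along maps `ψ₁ = ψ₂ ∘ χ`.
[cite: SerreFAC1955, n° 81] -/
structure IsComap {L : HolomorphicLineBundle ι E M} {L' : HolomorphicLineBundle ι E' M'}
    (C : L.FramedCover κ) (C' : L'.FramedCover κ) (ψ : M' → M) : Prop where
  /-- the members are the preimages -/
  U_eq : ∀ k, C'.U k = ψ ⁻¹' C.U k
  /-- the frames agree -/
  frame_eq : ∀ k, C'.frame k = C.frame k
  /-- the transition functions are composed with `ψ` -/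
  coordChange_eq : ∀ i j x, L'.coordChange i j x = L.coordChange i j (ψ x)

/-- **`C.comap ψ` is the pull-back of `C` along `ψ`.** [folklore] -/
theorem isComap_comap {L : HolomorphicLineBundle ι E M} (C : L.FramedCover κ) (ψ : M' → M)
    (hψ : MDifferentiable 𝓘(ℂ, E') 𝓘(ℂ, E) ψ) : IsComap C (C.comap ψ hψ) ψ :=
  ⟨fun _ ↦ rfl, fun _ ↦ rfl, fun _ _ _ ↦ rfl⟩

namespace IsComap

variable {L K : HolomorphicLineBundle ι E M} {L' K' : HolomorphicLineBundle ι E' M'}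
  {C : L.FramedCover κ} {C' : L'.FramedCover κ} {ψ : M' → M}

/-- The finite intersections are the preimages. [folklore] -/
theorem cechSet_eq (h : IsComap C C' ψ) {n : ℕ} (J : Fin n → κ) : cechSet C'.U J = ψ ⁻¹' cechSet C.U J := by
  ext x
  simp only [mem_cechSet_iff, mem_preimage, h.U_eq]

/-- Membership in the finite intersections. [folklore] -/
theorem mem_cechSet_iff' (h : IsComap C C' ψ) {n : ℕ} {J : Fin n → κ} {x : M'} :
    x ∈ cechSet C'.U J ↔ ψ x ∈ cechSet C.U J := by
  rw [h.cechSet_eq J]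
  rfl

/-- The changes of frame are composed with `ψ`. [folklore] -/
theorem trans_eq (h : IsComap C C' ψ) {m n : ℕ} (J : Fin (n + 1) → κ) (τ : Fin (m + 1) → Fin (n + 1))
    (x : M') : C'.trans J τ x = C.trans J τ (ψ x) := by
  unfold trans
  rw [h.frame_eq, h.frame_eq, h.coordChange_eq]

/-- A holomorphic function on `V_J` composed with `ψ` is holomorphic on `ψ⁻¹ V_J`, zero off it.
[folklore] -/
theorem comp_mem_holFunOn (h : IsComap C C' ψ) (hψ : MDifferentiable 𝓘(ℂ, E') 𝓘(ℂ, E) ψ) {n : ℕ} {J : Fin (n + 1) → κ}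
    (f : holFunOn E (cechSet C.U J)) : (fun x ↦ (f : M → ℂ) (ψ x)) ∈ holFunOn E' (cechSet C'.U J) := by
  refine ⟨?_, fun x hx ↦ ?_⟩
  · rw [h.cechSet_eq J]
    exact (holFunOn.mdifferentiableOn f).comp hψ.mdifferentiableOn fun _ hx ↦ hx
  · rw [h.mem_cechSet_iff'] at hx
    exact holFunOn.apply_of_notMem f hx

/-- **The cochain map `c ↦ c ∘ ψ`**, `C^a(𝔙, 𝒪(L)) → C^a(ψ⁻¹𝔙, 𝒪(L'))` (restriction of sections
along `ψ`, read in the same frames). [cite: SerreFAC1955, n° 81] -/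
def cochainMap (h : IsComap C C' ψ) (hψ : MDifferentiable 𝓘(ℂ, E') 𝓘(ℂ, E) ψ) (a : ℕ) : C.Cochain a →ₗ[ℂ] C'.Cochain a where
  toFun c J := ⟨fun x ↦ (c J : M → ℂ) (ψ x), h.comp_mem_holFunOn hψ (c J)⟩
  map_add' c c' := by
    funext J
    rfl
  map_smul' r c := by
    funext J
    rfl

/-- The cochain map, pointwise (definitional). [folklore] -/
@[simp]
theorem cochainMap_apply_apply (h : IsComap C C' ψ) (hψ : MDifferentiable 𝓘(ℂ, E') 𝓘(ℂ, E) ψ) {a : ℕ} (c : C.Cochain a) (J : Fin (a + 1) → κ)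
    (x : M') : (h.cochainMap hψ a c J : M' → ℂ) x = (c J : M → ℂ) (ψ x) :=
  rfl

/-- **Restriction along `ψ` commutes with the restriction maps of the sheaf of sections.** [folklore] -/
theorem face_cochainMap (h : IsComap C C' ψ) (hψ : MDifferentiable 𝓘(ℂ, E') 𝓘(ℂ, E) ψ) {m n : ℕ} (J : Fin (n + 1) → κ) (τ : Fin (m + 1) → Fin (n + 1))
    (f : holFunOn E (cechSet C.U (J ∘ τ))) (x : M') :
    (C'.face J τ ⟨fun x ↦ (f : M → ℂ) (ψ x), h.comp_mem_holFunOn hψ f⟩ : M' → ℂ) x =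
      (C.face J τ f : M → ℂ) (ψ x) := by
  by_cases hx : x ∈ cechSet C'.U J
  · rw [C'.face_apply_of_mem J τ _ hx, C.face_apply_of_mem J τ f (h.mem_cechSet_iff'.1 hx), h.trans_eq]
  · rw [C'.face_apply_of_notMem J τ _ hx, C.face_apply_of_notMem J τ f (fun h' ↦ hx (h.mem_cechSet_iff'.2 h'))]

/-- **`c ↦ c ∘ ψ` is a cochain map**: `δ' (c ∘ ψ) = (δ c) ∘ ψ`. [cite: SerreFAC1955, n° 81] -/
theorem delta_cochainMap (h : IsComap C C' ψ) (hψ : MDifferentiable 𝓘(ℂ, E') 𝓘(ℂ, E) ψ) (a : ℕ) (c : C.Cochain a) :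
    C'.delta a (h.cochainMap hψ a c) = h.cochainMap hψ (a + 1) (C.delta a c) := by
  funext J
  refine Subtype.ext (funext fun x ↦ ?_)
  rw [cochainMap_apply_apply, delta_apply, delta_apply, Submodule.coe_sum, Submodule.coe_sum,
    Finset.sum_apply, Finset.sum_apply]
  refine Finset.sum_congr rfl fun j _ ↦ ?_
  rw [Submodule.coe_smul, Submodule.coe_smul, Pi.smul_apply, Pi.smul_apply]
  congr 1
  exact h.face_cochainMap hψ J (Fin.succAbove j) (c (J ∘ Fin.succAbove j)) x

/-- **The induced map `Ȟ^q(𝔙, 𝒪(L)) → Ȟ^q(ψ⁻¹𝔙, 𝒪(L'))`.** [cite: SerreFAC1955, n° 81] -/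
def cohomologyMap (h : IsComap C C' ψ) (hψ : MDifferentiable 𝓘(ℂ, E') 𝓘(ℂ, E) ψ) (q : ℕ) : C.cohomology q →ₗ[ℂ] C'.cohomology q :=
  NatCochain.Cohomology.map (fun a ↦ h.cochainMap hψ a) (fun a c ↦ (h.delta_cochainMap hψ a c).symm) q

/-- **Restriction along `ψ` commutes with multiplication by a section and its pull-back**: for
sections `t` of `Hom(L, K)` and `t'` of `Hom(L', K')` with `t'_i = t_i ∘ ψ`,
`(t c) ∘ ψ = t' (c ∘ ψ)`. [cite: SerreGAGA1956, n° 16 (proof of Lemme 8)] -/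
theorem cochainMap_mulCochain (hC : IsComap C C' ψ) (hψ : MDifferentiable 𝓘(ℂ, E') 𝓘(ℂ, E) ψ) (t : HomSection L K) (t' : HomSection L' K')
    (ht : ∀ i x, t'.coord i x = t.coord i (ψ x)) (hK : ∀ k, C.U k ⊆ K.baseSet (C.frame k))
    (hK' : ∀ k, C'.U k ⊆ K'.baseSet (C'.frame k)) (hCK : IsComap (C.transfer K hK) (C'.transfer K' hK') ψ)
    (a : ℕ) (c : C.Cochain a) :
    hCK.cochainMap hψ a (C.mulCochain t hK a c) = C'.mulCochain t' hK' a (hC.cochainMap hψ a c) := by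
  funext J
  refine Subtype.ext (funext fun x ↦ ?_)
  rw [cochainMap_apply_apply]
  by_cases hx : x ∈ cechSet C'.U J
  · rw [C'.mulCochain_apply_apply_of_mem t' hK' _ hx, C.mulCochain_apply_apply_of_mem t hK c (hC.mem_cechSet_iff'.1 hx),
      ht, hC.frame_eq, cochainMap_apply_apply]
  · rw [C'.mulCochain_apply_apply_of_notMem t' hK' _ hx,
      C.mulCochain_apply_apply_of_notMem t hK c (fun h' ↦ hx (hC.mem_cechSet_iff'.2 h'))]

/-- The transferred covers of pulled-back covers are pulled back (same members and frames).
[folklore] -/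
theorem transfer (hC : IsComap C C' ψ) (hK : ∀ k, C.U k ⊆ K.baseSet (C.frame k))
    (hK' : ∀ k, C'.U k ⊆ K'.baseSet (C'.frame k)) (hKK' : ∀ i j x, K'.coordChange i j x = K.coordChange i j (ψ x)) :
    IsComap (C.transfer K hK) (C'.transfer K' hK') ψ :=
  ⟨hC.U_eq, hC.frame_eq, hKK'⟩

/-- **Pull-backs compose**: if `C'` is the pull-back of `C` along `ψ` and `C''` that of `C` along
`ψ ∘ χ`, then `C''` is the pull-back of `C'` along `χ`. [folklore] -/
theorem of_comp {E'' : Type*} [NormedAddCommGroup E''] [NormedSpace ℂ E''] {M'' : Type*}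
    [TopologicalSpace M''] [ChartedSpace E'' M''] {L'' : HolomorphicLineBundle ι E'' M''}
    {C'' : L''.FramedCover κ} {χ : M'' → M'} (h' : IsComap C C' ψ) (h'' : IsComap C C'' (ψ ∘ χ)) :
    IsComap C' C'' χ :=
  ⟨fun k ↦ by rw [h''.U_eq, h'.U_eq]; rfl, fun k ↦ by rw [h''.frame_eq, h'.frame_eq],
    fun i j x ↦ by rw [h''.coordChange_eq, h'.coordChange_eq]; rfl⟩

/-- The cochain maps compose accordingly: `(c ∘ ψ) ∘ χ = c ∘ (ψ ∘ χ)`. [folklore] -/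
theorem cochainMap_cochainMap {E'' : Type*} [NormedAddCommGroup E''] [NormedSpace ℂ E''] {M'' : Type*}
    [TopologicalSpace M''] [ChartedSpace E'' M''] {L'' : HolomorphicLineBundle ι E'' M''}
    {C'' : L''.FramedCover κ} {χ : M'' → M'} (hψ : MDifferentiable 𝓘(ℂ, E') 𝓘(ℂ, E) ψ) (hχ : MDifferentiable 𝓘(ℂ, E'') 𝓘(ℂ, E') χ)
    (h' : IsComap C C' ψ) (h'' : IsComap C C'' (ψ ∘ χ)) (a : ℕ) (c : C.Cochain a) :
    (h'.of_comp h'').cochainMap hχ a (h'.cochainMap hψ a c) = h''.cochainMap (hψ.comp hχ) a c :=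
  rfl

end IsComap

end FramedCover

end HolomorphicLineBundle

end Literature.Geometry.Kaehler
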